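import Mathlib
import HarnessLib
import Summits.AtomisticToContinuum.FouriersLaw.Theses.JunctionLocality
import Summits.AtomisticToContinuum.FouriersLaw.Theorems.JunctionLocalitySuperadditiveResistanceDeviceLiouville
import Summits.AtomisticToContinuum.FouriersLaw.Theorems.JunctionLocalitySuperadditiveResistanceStubDeviceForwardFieldsAux3
import Summits.AtomisticToContinuum.FouriersLaw.Theorems.JunctionLocalitySuperadditiveResistanceStubDeviceForwardFieldsAux5
import Summits.AtomisticToContinuum.FouriersLaw.Theorems.JunctionLocalitySuperadditiveResistanceStubDeviceForwardFieldsAux6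
import Summits.AtomisticToContinuum.FouriersLaw.Theorems.JunctionLocalitySuperadditiveResistanceStubKuboFrameAbelian
import Summits.AtomisticToContinuum.FouriersLaw.Theorems.JunctionLocalityConductanceLowerBoundRelocForwardFieldAnchors

/-!
# Relocated forward fields from a `λ`-uniform `L²(μ_T)` resolvent bound
(helper `stub_relocForwardField_of_resolventBound` toward stub `stub_relocForwardField` of line
`cold-bath-relocation-walk`, crux stmt-AtomisticToContinuum-11749 `JunctionLocality.ConductanceLowerBound`;
`--supports` stmt-AtomisticToContinuum-11749)

Setting: ONE `L`-site Hamiltonian `H` of `pinnedChain ω₂ lam β γ`, its Gibbs state `μ_T`, the hot thermostat on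
site `0` and the cold one RELOCATED to site `m < L`, all at `T`: `L_m = X_H + γ (S_0 + S_m) = X_H + γ S_{B_m}`,
`B_m = 𝟙_{i=0} + 𝟙_{i=m}` (`bathOp_twoSite_eq_thermo`).  The stub `stub_relocForwardField` asks for a classical
mean-zero `C² ∩ L²(μ_T)` solution of `L_m g = −(p_0² − T)` at every `m < L`; the anchor placements `m = L − 1`,
`m = 0` are landed (`…RelocForwardFieldAnchors`).  For interior `m` the landed general-weight toolkit gives,
for every `λ > 0`, smooth resolvent fields `g_λ ∈ L²(μ_T)`, `λ g_λ − L_m g_λ = p_0² − T`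
(`exists_resolventField`: essential m-dissipativity of `X_H + γ S_B` on `C_c^∞`, any `B ≥ 0` with `B_0 > 0`)
and Hörmander regularity of weak `L²(μ_T)` solutions (`exists_classical_of_weak_gibbs`).  THIS FILE proves the
honest reduction of the stub to the one missing input, an `L²(μ_T)` bound on the resolvent solutions UNIFORM IN
`λ ∈ (0, 1]` (quantitative ergodicity of the equilibrium Langevin NETWORK with baths on `{0, m}` and the passive
tail `m+1, …, L−1` attached — Cuneo–Eckmann–Hairer–Rey-Bellet, EJP 23 (2018) no. 55, Thm 2.13(3) in network
form; the tree's Harris construction `langevinKernel` is for END baths only):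

* `exists_forwardField_of_resolventBound` — GENERAL WEIGHTS `B ≥ 0`, `B_0 > 0`, friction `c > 0`, smooth source
  `k ∈ L²(μ_T)`: if every `C² ∩ L²(μ_T)` solution of `λ g − (X_H g + c S_B g) = k`, `λ ∈ (0,1]`, has
  `∫ g² dμ_T ≤ C`, then there is a smooth mean-zero `g ∈ L²(μ_T)` with `X_H g + c S_B g = −k` pointwise.
  Proof (Banach–Alaoglu, no semigroup; adapted from the landed device version
  `helper_forwardFieldIffResolventBound`): the classes `[g_λ]`, `λ ∈ (0,1]`, lie in a closed ball of the Hilbert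
  space `L²(μ_T)`, weak-* compact in its dual (`WeakDual.isCompact_closedBall`); a cluster point `g_cl` of
  `λ → 0⁺` inherits every convergent pairing, in particular
  `⟨g_λ, −X_H φ + c S_B φ⟩ = λ⟨g_λ, φ⟩ − ⟨k, φ⟩ → −⟨k, φ⟩` for `φ ∈ C_c^∞` (`integral_adjointOp_mul_resolvent`), so
  `g_cl` is a weak `L²(μ_T)` solution of `X_H g + c S_B g = −k`, made classical by `exists_classical_of_weak_gibbs`
  and recentred (the operator kills constants).
* `stub_relocForwardField_of_resolventBound` — the registered reduction: the `λ`-uniform bound for the relocated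
  thermostats (`c = γ`, `B = B_m`, `k = p_0² − T ∈ L²(μ_T)` by `pinnedChain_memLp_two_kin`) implies the exact
  signature of `stub_relocForwardField`.
* `relocForwardField_of_resolventBoundAt` (pointwise in `(L, m)`) and
  `stub_relocForwardField_of_interiorResolventBound` — the RESIDUAL: with the two anchors landed, the bound is
  needed at the interior placements `1 ≤ m ≤ L − 2` only.
No definitions; standard axioms.
-/

noncomputable section

open MeasureTheory Filter Topology
open scoped ContDiff InnerProductSpace
open Literature.MathematicalPhysics.KineticTheory.HeatConduction
open Summit.AtomisticToContinuum.FouriersLaw.Theorems.SuperadditiveResistance.DeviceLiouville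
  (kin thermo liouvilleOp bathOp kin_eq_sq continuous_kin)
open Summit.AtomisticToContinuum.FouriersLaw.Cruxes.SuperadditiveResistance.FloatingProbeBypassLaplacian
  (partialP_sub_const' exists_classical_of_weak_gibbs exists_resolventField pinnedChain_memLp_two_kin
    inner_toLp_left inner_toLp_toLp norm_toLp_sq memLp_two_of_hasCompactSupport continuous_genOp
    hasCompactSupport_genOp)
open Summit.AtomisticToContinuum.FouriersLaw.Cruxes.SuperadditiveResistance.ThermaliseThenCutProbeInsertion
  (integral_adjointOp_mul_resolvent)

namespace Summit.AtomisticToContinuum.FouriersLaw.Cruxes.ConductanceLowerBound.ColdBathRelocationWalk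

/-! ## Bookkeeping -/

section Bridge

variable {L : ℕ}

/-- The weighted bath operator of the relocated weights `𝟙_{i=0} + 𝟙_{i=m}` is the sum of the two single-site
thermostats `S_0 + S_m` (as `thermo L 0 T + thermo L m T`). [folklore] -/
theorem bathOp_twoSite_eq_thermo (L m : ℕ) (T : ℝ) (g : PhaseSpace L → ℝ) (x : PhaseSpace L) :
    bathOp L (fun i : Fin L => (if i.val = 0 then (1 : ℝ) else 0) + (if i.val = m then 1 else 0)) T g x =
      thermo L 0 T g x + thermo L m T g x := by
  -- adapted from the line skeleton's `bathOp_relocWeight`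
  simp only [bathOp, thermo, ← Finset.sum_add_distrib]
  refine Finset.sum_congr rfl fun i _ => ?_
  split_ifs <;> ring

/-- A weighted bath operator annihilates constants: `S_B (f − a) = S_B f`. [folklore] -/
theorem bathOp_sub_const (B : Fin L → ℝ) (T : ℝ) (f : PhaseSpace L → ℝ) (a : ℝ) (x : PhaseSpace L) :
    bathOp L B T (fun y => f y - a) x = bathOp L B T f x := by
  simp only [bathOp, partialP_sub_const']

/-- `p_s² − T` (in the `kin` form) is smooth. [folklore] -/
theorem contDiff_kin_sub_const (L s : ℕ) (T : ℝ) : ContDiff ℝ ∞ (fun x : PhaseSpace L => kin L s x - T) := by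
  -- adapted from `exists_deviceResolventField`
  unfold kin
  refine ContDiff.sub (ContDiff.sum fun i _ => ?_) contDiff_const
  split_ifs
  · exact ((contDiff_apply ℝ ℝ i).comp contDiff_snd).pow 2
  · exact contDiff_const

end Bridge

/-! ## Forward fields from bounded resolvent fields (general site weights) -/

section General

variable {ω₂ lam β : ℝ} {L : ℕ}

/-- **Forward fields from a `λ`-uniform `L²(μ_T)` resolvent bound, general weights.** For `pinnedChain ω₂ lam β γ`
(`ω₂ > 0`, `lam, β ≥ 0`), `L ≥ 1`, `T > 0`, friction `c > 0`, site weights `B ≥ 0` with `B_0 > 0` and a smooth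
source `k ∈ L²(μ_T)`: if for some `C` every `g ∈ C² ∩ L²(μ_T)` solving `λ g − (X_H g + c S_B g) = k` pointwise
with `λ ∈ (0, 1]` has `∫ g² dμ_T ≤ C`, then there is a smooth mean-zero `g ∈ L²(μ_T)` with
`X_H g + c S_B g = −k` pointwise.  (Resolvent fields exist by `exists_resolventField`; Banach–Alaoglu cluster point
of `λ → 0⁺` in `L²(μ_T)`; hypoelliptic regularity `exists_classical_of_weak_gibbs`; recentring.)
(adapted from `helper_forwardFieldIffResolventBound`) [folklore] -/
theorem exists_forwardField_of_resolventBound (hω : 0 < ω₂) (hl : 0 ≤ lam) (hβ : 0 ≤ β) (γ : ℝ)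
    (hL : 0 < L) {T : ℝ} (hT : 0 < T) {c : ℝ} (hc : 0 < c) {B : Fin L → ℝ} (hB : ∀ i, 0 ≤ B i)
    (hB0 : 0 < B ⟨0, hL⟩) {k : PhaseSpace L → ℝ} (hks : ContDiff ℝ ∞ k)
    (hk : MemLp k 2 ((pinnedChain ω₂ lam β γ).gibbsMeasure L T))
    (hbound : ∃ C : ℝ, ∀ κ : ℝ, 0 < κ → κ ≤ 1 → ∀ g : PhaseSpace L → ℝ, ContDiff ℝ 2 g →
      MemLp g 2 ((pinnedChain ω₂ lam β γ).gibbsMeasure L T) →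
      (∀ x, κ * g x - (liouvilleOp (pinnedChain ω₂ lam β γ) L g x + c * bathOp L B T g x) = k x) →
      ∫ x, g x ^ 2 ∂((pinnedChain ω₂ lam β γ).gibbsMeasure L T) ≤ C) :
    ∃ g : PhaseSpace L → ℝ, ContDiff ℝ ∞ g ∧ MemLp g 2 ((pinnedChain ω₂ lam β γ).gibbsMeasure L T) ∧
      ∫ x, g x ∂((pinnedChain ω₂ lam β γ).gibbsMeasure L T) = 0 ∧
      ∀ x, liouvilleOp (pinnedChain ω₂ lam β γ) L g x + c * bathOp L B T g x = -k x := by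
  -- the setting
  set P := pinnedChain ω₂ lam β γ with hP
  haveI : IsProbabilityMeasure (P.gibbsMeasure L T) :=
    pinnedChain_isProbabilityMeasure_gibbsMeasure hω hl hβ γ L hT
  have hU1 : ContDiff ℝ 1 P.U := pinnedChain_contDiff_U ω₂ lam β γ
  have hV1 : ContDiff ℝ 1 P.V := pinnedChain_contDiff_V ω₂ lam β γ
  obtain ⟨C, hC⟩ := hbound
  -- a family of resolvent fields `g κ`, `κ > 0` (choice over the landed existence theorem)
  have hex : ∀ κ : ℝ, 0 < κ → ∃ g : PhaseSpace L → ℝ, ContDiff ℝ 2 g ∧ MemLp g 2 (P.gibbsMeasure L T) ∧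
      ∀ x, κ * g x - (liouvilleOp P L g x + c * bathOp L B T g x) = k x := by
    intro κ hκ
    obtain ⟨g, hgC, hg2, hpde⟩ := exists_resolventField hω hl hβ γ hL hT one_ne_zero hc hB hB0 hκ hks hk
    exact ⟨g, hgC.of_le (by norm_cast), hg2, fun x => by simpa only [one_mul] using hpde x⟩
  choose gfam hgfam using hex
  set g : ℝ → PhaseSpace L → ℝ := fun κ => if h : 0 < κ then gfam κ h else fun _ => 0 with hgdef
  have hg : ∀ κ : ℝ, 0 < κ → ContDiff ℝ 2 (g κ) ∧ MemLp (g κ) 2 (P.gibbsMeasure L T) ∧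
      ∀ x, κ * g κ x - (liouvilleOp P L (g κ) x + c * bathOp L B T (g κ) x) = k x := by
    intro κ hκ
    have e : g κ = gfam κ hκ := by simp only [hgdef, dif_pos hκ]
    rw [e]
    exact hgfam κ hκ
  have hC2 : ∀ κ, 0 < κ → ContDiff ℝ 2 (g κ) := fun κ hκ => (hg κ hκ).1
  have hL2 : ∀ κ, 0 < κ → MemLp (g κ) 2 (P.gibbsMeasure L T) := fun κ hκ => (hg κ hκ).2.1
  have hpair : ∀ κ, 0 < κ → ∀ x, 1 * liouvilleOp P L (g κ) x + c * bathOp L B T (g κ) x =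
      -(k x - κ * g κ x) := by
    intro κ hκ x
    have e := (hg κ hκ).2.2 x
    linarith
  have hev : ∀ᶠ κ in 𝓝[>] (0 : ℝ), 0 < κ := eventually_mem_nhdsWithin
  -- the classes `G κ = [g_κ]` and their bound
  set G : ℝ → Lp ℝ 2 (P.gibbsMeasure L T) := fun κ =>
    if h : 0 < κ then (hL2 κ h).toLp (g κ) else 0 with hGdef
  have hGpos : ∀ κ (hκ : 0 < κ), G κ = (hL2 κ hκ).toLp (g κ) := fun κ hκ => by simp only [hGdef, dif_pos hκ]
  set R : ℝ := Real.sqrt C with hR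
  have hGnorm : ∀ κ, 0 < κ → κ ≤ 1 → ‖G κ‖ ≤ R := by
    intro κ hκ hκ1
    have h1 : ‖G κ‖ ^ 2 ≤ C := by
      rw [hGpos κ hκ, norm_toLp_sq]
      exact hC κ hκ hκ1 (g κ) (hC2 κ hκ) (hL2 κ hκ) (hg κ hκ).2.2
    simpa only [abs_of_nonneg (norm_nonneg _)] using Real.abs_le_sqrt h1
  -- weak-* compactness of the ball and a cluster point of `κ → 0⁺`
  set Φ : ℝ → WeakDual ℝ (Lp ℝ 2 (P.gibbsMeasure L T)) := fun κ =>
    StrongDual.toWeakDual (InnerProductSpace.toDual ℝ (Lp ℝ 2 (P.gibbsMeasure L T)) (G κ)) with hΦdef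
  have hΦapply : ∀ κ (u : Lp ℝ 2 (P.gibbsMeasure L T)), Φ κ u = ⟪G κ, u⟫_ℝ := fun κ u => rfl
  have hK : IsCompact (WeakDual.toStrongDual ⁻¹' Metric.closedBall
      (0 : StrongDual ℝ (Lp ℝ 2 (P.gibbsMeasure L T))) R) := WeakDual.isCompact_closedBall 0 R
  have hFK : Filter.map Φ (𝓝[>] 0) ≤ 𝓟 (WeakDual.toStrongDual ⁻¹' Metric.closedBall
      (0 : StrongDual ℝ (Lp ℝ 2 (P.gibbsMeasure L T))) R) := by
    refine Filter.le_principal_iff.2 (Filter.mem_map.2 ?_)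
    filter_upwards [Ioc_mem_nhdsGT zero_lt_one] with κ hκ
    show WeakDual.toStrongDual (Φ κ) ∈ Metric.closedBall _ R
    rw [mem_closedBall_zero_iff]
    show ‖InnerProductSpace.toDual ℝ (Lp ℝ 2 (P.gibbsMeasure L T)) (G κ)‖ ≤ R
    rw [LinearIsometryEquiv.norm_map]
    exact hGnorm κ hκ.1 hκ.2
  obtain ⟨x, -, hx⟩ := hK.exists_clusterPt hFK
  set gcl : Lp ℝ 2 (P.gibbsMeasure L T) :=
    (InnerProductSpace.toDual ℝ (Lp ℝ 2 (P.gibbsMeasure L T))).symm (WeakDual.toStrongDual x) with hgcl_def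
  have hgcl : ∀ u : Lp ℝ 2 (P.gibbsMeasure L T), ⟪gcl, u⟫_ℝ = x u := fun u => by
    rw [hgcl_def, ← InnerProductSpace.toDual_apply_apply (𝕜 := ℝ), LinearIsometryEquiv.apply_symm_apply]
    rfl
  -- a cluster point inherits every convergent pairing
  have key : ∀ (u : Lp ℝ 2 (P.gibbsMeasure L T)) (a : ℝ),
      Tendsto (fun κ => ⟪G κ, u⟫_ℝ) (𝓝[>] 0) (𝓝 a) → ⟪gcl, u⟫_ℝ = a := by
    intro u a ha
    have h1 : ClusterPt (x u) (Filter.map (fun y : WeakDual ℝ (Lp ℝ 2 (P.gibbsMeasure L T)) => y u)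
        (Filter.map Φ (𝓝[>] 0))) :=
      hx.map (WeakDual.eval_continuous u).continuousAt tendsto_map
    rw [Filter.map_map] at h1
    have h2 : Filter.map ((fun y : WeakDual ℝ (Lp ℝ 2 (P.gibbsMeasure L T)) => y u) ∘ Φ) (𝓝[>] 0) ≤ 𝓝 a := by
      have : ((fun y : WeakDual ℝ (Lp ℝ 2 (P.gibbsMeasure L T)) => y u) ∘ Φ) = fun κ => ⟪G κ, u⟫_ℝ :=
        funext fun κ => hΦapply κ u
      rw [this]
      exact ha
    rw [hgcl]
    exact eq_of_nhds_neBot (h1.mono h2).neBot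
  -- the weak equation of the cluster point
  have hNmem : ∀ (f : PhaseSpace L → ℝ), ContDiff ℝ ∞ f → HasCompactSupport f →
      MemLp (fun y => (-1) * liouvilleOp P L f y + c * bathOp L B T f y + 0 * f y) 2 (P.gibbsMeasure L T) :=
    fun f hf hfc =>
    memLp_two_of_hasCompactSupport _ (continuous_genOp hU1 hV1 L (-1) c 0 B T (hf.of_le (by norm_cast)))
      (hasCompactSupport_genOp L (-1) c 0 B T (hf.of_le (by norm_cast)) hfc)
  have hweak_cl : ∀ φ : PhaseSpace L → ℝ, ContDiff ℝ ∞ φ → HasCompactSupport φ →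
      ∫ y, (-1 * liouvilleOp P L φ y + c * bathOp L B T φ y + 0 * φ y) * gcl y ∂(P.gibbsMeasure L T) =
        ∫ y, (fun z => -k z) y * φ y ∂(P.gibbsMeasure L T) := by
    intro φ hφ hφc
    have hφ2 : ContDiff ℝ 2 φ := hφ.of_le (by norm_cast)
    have hφL2 : MemLp φ 2 (P.gibbsMeasure L T) := memLp_two_of_hasCompactSupport _ hφ.continuous hφc
    have hform : ∀ᶠ κ in 𝓝[>] (0 : ℝ), ⟪G κ, (hNmem φ hφ hφc).toLp _⟫_ℝ =
        κ * ⟪G κ, hφL2.toLp φ⟫_ℝ - ∫ y, φ y * k y ∂(P.gibbsMeasure L T) := by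
      filter_upwards [hev] with κ hκ
      rw [hGpos κ hκ, inner_toLp_toLp, inner_toLp_toLp]
      have hadj := integral_adjointOp_mul_resolvent hω hl hβ L hT B 1 c κ hφ2 hφc (hC2 κ hκ) (hL2 κ hκ) hk
        (hpair κ hκ)
      have e1 : ∫ y, g κ y * ((-1) * liouvilleOp P L φ y + c * bathOp L B T φ y + 0 * φ y)
          ∂(P.gibbsMeasure L T) =
          ∫ y, (-1 * liouvilleOp P L φ y + c * bathOp L B T φ y + 0 * φ y) * g κ y ∂(P.gibbsMeasure L T) :=
        integral_congr_ae (ae_of_all _ fun y => by ring)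
      have e2 : ∫ y, φ y * g κ y ∂(P.gibbsMeasure L T) = ∫ y, g κ y * φ y ∂(P.gibbsMeasure L T) :=
        integral_congr_ae (ae_of_all _ fun y => by ring)
      rw [e1, hadj, e2]
    have hlim1 : Tendsto (fun κ : ℝ => κ * ⟪G κ, hφL2.toLp φ⟫_ℝ) (𝓝[>] 0) (𝓝 0) := by
      refine squeeze_zero_norm' (a := fun κ : ℝ => |κ| * (R * ‖hφL2.toLp φ‖)) ?_ ?_
      · filter_upwards [Ioc_mem_nhdsGT zero_lt_one] with κ hκ
        rw [Real.norm_eq_abs, abs_mul]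
        refine mul_le_mul_of_nonneg_left ?_ (abs_nonneg κ)
        exact (abs_real_inner_le_norm _ _).trans (mul_le_mul_of_nonneg_right (hGnorm κ hκ.1 hκ.2) (norm_nonneg _))
      · refine tendsto_nhdsWithin_of_tendsto_nhds ?_
        simpa using ((continuous_abs.tendsto (0 : ℝ)).mul_const (R * ‖hφL2.toLp φ‖))
    have hlim : Tendsto (fun κ => ⟪G κ, (hNmem φ hφ hφc).toLp _⟫_ℝ) (𝓝[>] 0)
        (𝓝 (-∫ y, φ y * k y ∂(P.gibbsMeasure L T))) := by
      have := hlim1.sub (tendsto_const_nhds (x := ∫ y, φ y * k y ∂(P.gibbsMeasure L T)))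
      rw [zero_sub] at this
      exact this.congr' (hform.mono fun κ h => h.symm)
    have hval := key _ _ hlim
    rw [real_inner_comm, inner_toLp_left] at hval
    have e4 : ∫ y, (fun z => -k z) y * φ y ∂(P.gibbsMeasure L T) = -∫ y, φ y * k y ∂(P.gibbsMeasure L T) := by
      rw [← integral_neg]
      exact integral_congr_ae (ae_of_all _ fun y => by simp only; ring)
    rw [hval, e4]
  -- hypoelliptic regularity of the cluster point, then recentring
  obtain ⟨g', hg'C, hae, hpde⟩ := exists_classical_of_weak_gibbs hω hl hβ γ hL hT one_ne_zero hc hB hB0 0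
    ((Lp.memLp gcl).integrable one_le_two) hks.neg hweak_cl
  have hg'L2 : MemLp g' 2 (P.gibbsMeasure L T) := (Lp.memLp gcl).ae_eq hae
  set a₀ : ℝ := ∫ y, g' y ∂(P.gibbsMeasure L T) with ha₀
  refine ⟨fun y => g' y - a₀, hg'C.sub contDiff_const, hg'L2.sub (memLp_const a₀), ?_, fun y => ?_⟩
  · have hgi : Integrable g' (P.gibbsMeasure L T) := hg'L2.integrable one_le_two
    rw [integral_sub hgi (integrable_const a₀), integral_const]
    simp [probReal_univ, ha₀]
  · rw [liouvilleOp_sub_const, bathOp_sub_const]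
    have e := hpde y
    rw [one_mul, zero_mul, add_zero] at e
    exact e

end General

/-! ## The registered reduction -/

/-- **`stub_relocForwardField` from ONE named analytic input.**  If, for all parameters `> 0`, `T > 0`, every `L`
and every cold-bath position `m < L`, the `C² ∩ L²(μ_T)` solutions of the relocated resolvent equation
`λ g − (X_H g + γ (S_0 g + S_m g)) = p_0² − T` are bounded in `L²(μ_T)` uniformly in `λ ∈ (0, 1]`
(quantitative ergodicity of the equilibrium Langevin network with baths on `{0, m}`: Cuneo–Eckmann–Hairer–
Rey-Bellet 2018 Thm 2.13(3), network form — NOT in the tree for these weights), then relocated forward fields exist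
at every `m < L`: the registered signature of `stub_relocForwardField` (via `exists_forwardField_of_resolventBound`
with `c = γ`, `B = 𝟙_0 + 𝟙_m`, `k = p_0² − T`). [folklore] -/
theorem stub_relocForwardField_of_resolventBound : (∀ (ω₂ lam β γ T : ℝ), 0 < ω₂ → 0 < lam → 0 < β → 0 < γ → 0 < T → ∀ (L m : ℕ), m < L → ∃ M : ℝ, ∀ lam0 : ℝ, 0 < lam0 → lam0 ≤ 1 → ∀ gl : PhaseSpace L → ℝ, ContDiff ℝ 2 gl → MemLp gl 2 ((pinnedChain ω₂ lam β γ).gibbsMeasure L T) → (∀ x, lam0 * gl x - (liouvilleOp (pinnedChain ω₂ lam β γ) L gl x + γ * (thermo L 0 T gl x + thermo L m T gl x)) = kin L 0 x - T) → ∫ x, gl x ^ 2 ∂((pinnedChain ω₂ lam β γ).gibbsMeasure L T) ≤ M) → ∀ (ω₂ lam β γ T : ℝ), 0 < ω₂ → 0 < lam → 0 < β → 0 < γ → 0 < T → ∀ (L m : ℕ), m < L → ∃ g : PhaseSpace L → ℝ, ContDiff ℝ 2 g ∧ MemLp g 2 ((pinnedChain ω₂ lam β γ).gibbsMeasure L T)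 ∧ ∫ x, g x ∂((pinnedChain ω₂ lam β γ).gibbsMeasure L T) = 0 ∧ ∀ x, liouvilleOp (pinnedChain ω₂ lam β γ) L g x + γ * (thermo L 0 T g x + thermo L m T g x) = -(kin L 0 x - T) := by
  intro hres ω₂ lam β γ T hω hl hβ hγ hT L m hm
  have hL : 0 < L := by omega
  haveI : IsProbabilityMeasure ((pinnedChain ω₂ lam β γ).gibbsMeasure L T) :=
    pinnedChain_isProbabilityMeasure_gibbsMeasure hω hl.le hβ.le γ L hT
  set B : Fin L → ℝ := fun i => (if i.val = 0 then (1 : ℝ) else 0) + (if i.val = m then 1 else 0) with hBdef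
  have hB : ∀ i, 0 ≤ B i := fun i => by
    simp only [hBdef]
    split_ifs <;> norm_num
  have hB0 : 0 < B ⟨0, hL⟩ := by
    simp only [hBdef, if_true]
    split_ifs <;> norm_num
  have hbridge : ∀ (f : PhaseSpace L → ℝ) (x : PhaseSpace L),
      bathOp L B T f x = thermo L 0 T f x + thermo L m T f x := fun f x => bathOp_twoSite_eq_thermo L m T f x
  have hks : ContDiff ℝ ∞ (fun x : PhaseSpace L => kin L 0 x - T) := contDiff_kin_sub_const L 0 T
  have hk : MemLp (fun x : PhaseSpace L => kin L 0 x - T) 2 ((pinnedChain ω₂ lam β γ).gibbsMeasure L T) :=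
    (pinnedChain_memLp_two_kin hω hl.le hβ.le γ L 0 hT).sub (memLp_const T)
  obtain ⟨M, hM⟩ := hres ω₂ lam β γ T hω hl hβ hγ hT L m hm
  have hbound : ∃ C : ℝ, ∀ κ : ℝ, 0 < κ → κ ≤ 1 → ∀ g : PhaseSpace L → ℝ, ContDiff ℝ 2 g →
      MemLp g 2 ((pinnedChain ω₂ lam β γ).gibbsMeasure L T) →
      (∀ x, κ * g x - (liouvilleOp (pinnedChain ω₂ lam β γ) L g x + γ * bathOp L B T g x) =
        kin L 0 x - T) →
      ∫ x, g x ^ 2 ∂((pinnedChain ω₂ lam β γ).gibbsMeasure L T) ≤ C := by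
    refine ⟨M, fun κ hκ hκ1 g hgC hg2 hpde => hM κ hκ hκ1 g hgC hg2 fun x => ?_⟩
    rw [← hbridge]
    exact hpde x
  obtain ⟨g, hgC, hg2, hmean, hpde⟩ := exists_forwardField_of_resolventBound hω hl.le hβ.le γ hL hT hγ hB hB0
    hks hk hbound
  refine ⟨g, hgC.of_le (by norm_cast), hg2, hmean, fun x => ?_⟩
  rw [← hbridge]
  exact hpde x

/-! ## Pointwise form and the interior residual

The registered reduction above asks for the resolvent bound at EVERY placement `m < L`; the two anchor placements
need none (`relocForwardField_end`, `relocForwardField_anchor`, landed in `…RelocForwardFieldAnchors`), so the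
residual input of `stub_relocForwardField` is the bound at the INTERIOR placements `1 ≤ m ≤ L − 2` only. -/

/-- **Pointwise form of the reduction**: at a fixed placement `m < L`, an `L²(μ_T)` bound, uniform in
`λ ∈ (0, 1]`, on the `C² ∩ L²(μ_T)` solutions of `λ g − (X_H g + γ (S_0 g + S_m g)) = p_0² − T` yields a relocated
forward field at `m`. [folklore] -/
theorem relocForwardField_of_resolventBoundAt {ω₂ lam β γ T : ℝ} (hω : 0 < ω₂) (hl : 0 < lam) (hβ : 0 < β)
    (hγ : 0 < γ) (hT : 0 < T) {L m : ℕ} (hm : m < L)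
    (hres : ∃ M : ℝ, ∀ lam0 : ℝ, 0 < lam0 → lam0 ≤ 1 → ∀ gl : PhaseSpace L → ℝ, ContDiff ℝ 2 gl →
      MemLp gl 2 ((pinnedChain ω₂ lam β γ).gibbsMeasure L T) →
      (∀ x, lam0 * gl x - (liouvilleOp (pinnedChain ω₂ lam β γ) L gl x +
        γ * (thermo L 0 T gl x + thermo L m T gl x)) = kin L 0 x - T) →
      ∫ x, gl x ^ 2 ∂((pinnedChain ω₂ lam β γ).gibbsMeasure L T) ≤ M) :
    ∃ g : PhaseSpace L → ℝ, ContDiff ℝ 2 g ∧ MemLp g 2 ((pinnedChain ω₂ lam β γ).gibbsMeasure L T) ∧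
      ∫ x, g x ∂((pinnedChain ω₂ lam β γ).gibbsMeasure L T) = 0 ∧
      ∀ x, liouvilleOp (pinnedChain ω₂ lam β γ) L g x + γ * (thermo L 0 T g x + thermo L m T g x) =
        -(kin L 0 x - T) := by
  have hL : 0 < L := by omega
  haveI : IsProbabilityMeasure ((pinnedChain ω₂ lam β γ).gibbsMeasure L T) :=
    pinnedChain_isProbabilityMeasure_gibbsMeasure hω hl.le hβ.le γ L hT
  set B : Fin L → ℝ := fun i => (if i.val = 0 then (1 : ℝ) else 0) + (if i.val = m then 1 else 0) with hBdef
  have hB : ∀ i, 0 ≤ B i := fun i => by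
    simp only [hBdef]
    split_ifs <;> norm_num
  have hB0 : 0 < B ⟨0, hL⟩ := by
    simp only [hBdef, if_true]
    split_ifs <;> norm_num
  have hbridge : ∀ (f : PhaseSpace L → ℝ) (x : PhaseSpace L),
      bathOp L B T f x = thermo L 0 T f x + thermo L m T f x := fun f x => bathOp_twoSite_eq_thermo L m T f x
  have hks : ContDiff ℝ ∞ (fun x : PhaseSpace L => kin L 0 x - T) := contDiff_kin_sub_const L 0 T
  have hk : MemLp (fun x : PhaseSpace L => kin L 0 x - T) 2 ((pinnedChain ω₂ lam β γ).gibbsMeasure L T) :=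
    (pinnedChain_memLp_two_kin hω hl.le hβ.le γ L 0 hT).sub (memLp_const T)
  obtain ⟨M, hM⟩ := hres
  have hbound : ∃ C : ℝ, ∀ κ : ℝ, 0 < κ → κ ≤ 1 → ∀ g : PhaseSpace L → ℝ, ContDiff ℝ 2 g →
      MemLp g 2 ((pinnedChain ω₂ lam β γ).gibbsMeasure L T) →
      (∀ x, κ * g x - (liouvilleOp (pinnedChain ω₂ lam β γ) L g x + γ * bathOp L B T g x) =
        kin L 0 x - T) →
      ∫ x, g x ^ 2 ∂((pinnedChain ω₂ lam β γ).gibbsMeasure L T) ≤ C := by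
    refine ⟨M, fun κ hκ hκ1 g hgC hg2 hpde => hM κ hκ hκ1 g hgC hg2 fun x => ?_⟩
    rw [← hbridge]
    exact hpde x
  obtain ⟨g, hgC, hg2, hmean, hpde⟩ := exists_forwardField_of_resolventBound hω hl.le hβ.le γ hL hT hγ hB hB0
    hks hk hbound
  refine ⟨g, hgC.of_le (by norm_cast), hg2, hmean, fun x => ?_⟩
  rw [← hbridge]
  exact hpde x

/-- **`stub_relocForwardField` from the INTERIOR resolvent bound only.**  If for all parameters `> 0`, `T > 0`
and every interior placement `1 ≤ m ≤ L − 2` the `C² ∩ L²(μ_T)` solutions of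
`λ g − (X_H g + γ (S_0 g + S_m g)) = p_0² − T` are bounded in `L²(μ_T)` uniformly in `λ ∈ (0, 1]`
(CEHR 2018 Thm 2.13(3), network form, for the bath weights `𝟙_0 + 𝟙_m` — not in the tree), then relocated forward
fields exist at EVERY `m < L`: the anchors `m = 0` (`relocForwardField_anchor`) and `m = L − 1`
(`relocForwardField_end`, the landed plain forward field) need no ergodic input. [folklore] -/
theorem stub_relocForwardField_of_interiorResolventBound : (∀ (ω₂ lam β γ T : ℝ), 0 < ω₂ → 0 < lam → 0 < β → 0 < γ → 0 < T → ∀ (L m : ℕ), 1 ≤ m → m + 2 ≤ L → ∃ M : ℝ, ∀ lam0 : ℝ, 0 < lam0 → lam0 ≤ 1 → ∀ gl : PhaseSpace L → ℝ, ContDiff ℝ 2 gl → MemLp gl 2 ((pinnedChain ω₂ lam β γ).gibbsMeasure L T) → (∀ x, lam0 * gl x - (liouvilleOp (pinnedChain ω₂ lam β γ) L gl x + γ * (thermo L 0 T gl x + thermo L m T gl x)) = kin L 0 x - T) → ∫ x, gl x ^ 2 ∂((pinnedChain ω₂ lam β γ).gibbsMeasure L T) ≤ M) → ∀ (ω₂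 lam β γ T : ℝ), 0 < ω₂ → 0 < lam → 0 < β → 0 < γ → 0 < T → ∀ (L m : ℕ), m < L → ∃ g : PhaseSpace L → ℝ, ContDiff ℝ 2 g ∧ MemLp g 2 ((pinnedChain ω₂ lam β γ).gibbsMeasure L T) ∧ ∫ x, g x ∂((pinnedChain ω₂ lam β γ).gibbsMeasure L T) = 0 ∧ ∀ x, liouvilleOp (pinnedChain ω₂ lam β γ) L g x + γ * (thermo L 0 T g x + thermo L m T g x) = -(kin L 0 x - T) := by
  intro hres ω₂ lam β γ T hω hl hβ hγ hT L m hm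
  rcases Nat.eq_zero_or_pos m with h0 | hmpos
  · -- the anchor `m = 0`
    subst h0
    exact relocForwardField_anchor ω₂ lam β γ T hω hl hβ hγ hT L hm
  · by_cases hint : m + 2 ≤ L
    · -- an interior placement
      exact relocForwardField_of_resolventBoundAt hω hl hβ hγ hT hm
        (hres ω₂ lam β γ T hω hl hβ hγ hT L m hmpos hint)
    · -- the end placement `m = L − 1`
      obtain rfl : m = L - 1 := by omega
      exact relocForwardField_end ω₂ lam β γ T hω hl hβ hγ hT L (by omega)

end Summit.AtomisticToContinuum.FouriersLaw.Cruxes.ConductanceLowerBound.ColdBathRelocationWalk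

end
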